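import Summits.MatrixMultiplication.MatrixMultiplication.Theorems.AbelianSTPPCensusTB4StatDefs

/-!
# T_B static certificate, range `5591 … 5994` (t*-indexed linear checker with the k-member tree at `τ = 2375/1000`): kernel evaluation, the completeness of the bucket lists, volumes `1501 … (chunk starting 1951)` (small volume chunks: the kernel recursion through the long low-`t` lists is bounded per theorem)

Cell mm-stpp (rung F-M1), tier T_B = «beat `2.375` (Coppersmith–Winograd)»; checker in `AbelianSTPPCensusTB4StatDefs.lean`, table and bucket lists in `AbelianSTPPCensusTB4StatData.lean`
(pattern: theory g12's `AbelianSTPPCensusTAStatDDom*/DCk*.lean`).  `decide` with kernel reduction (standard axioms; no `native_decide`), `Elab.async false`;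
consumed by `TB4Stat.checkV_sound` / `TB4Stat.domV_sound` / `TB4Stat.m2V_sound` in the leaf `AbelianSTPPCensusLeafTB5994Closed.lean`.
WHAT THIS IS NOT: arithmetic on shape lists only; no statement about STPP families or `ω`.
-/

set_option linter.dupNamespace false
set_option autoImplicit false
set_option Elab.async false

namespace Summit.MatrixMultiplication.MatrixMultiplication.Theorems.TB4Stat

set_option maxHeartbeats 0 in
/-- Completeness chunk: every sorted candidate shape of the volumes `1501 … 1550` lies in the list of the bucket of its `a·b` (372 shapes). [original] -/
theorem m2c1501 : TB4Stat.m2V 50 1501 = true := by decide +kernel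

set_option maxHeartbeats 0 in
/-- Completeness chunk: every sorted candidate shape of the volumes `1551 … 1600` lies in the list of the bucket of its `a·b` (403 shapes). [original] -/
theorem m2c1551 : TB4Stat.m2V 50 1551 = true := by decide +kernel

set_option maxHeartbeats 0 in
/-- Completeness chunk: every sorted candidate shape of the volumes `1601 … 1650` lies in the list of the bucket of its `a·b` (372 shapes). [original] -/
theorem m2c1601 : TB4Stat.m2V 50 1601 = true := by decide +kernel

set_option maxHeartbeats 0 in
/-- Completeness chunk: every sorted candidate shape of the volumes `1651 … 1700` lies in the list of the bucket of its `a·b` (382 shapes). [original] -/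
theorem m2c1651 : TB4Stat.m2V 50 1651 = true := by decide +kernel

set_option maxHeartbeats 0 in
/-- Completeness chunk: every sorted candidate shape of the volumes `1701 … 1750` lies in the list of the bucket of its `a·b` (389 shapes). [original] -/
theorem m2c1701 : TB4Stat.m2V 50 1701 = true := by decide +kernel

set_option maxHeartbeats 0 in
/-- Completeness chunk: every sorted candidate shape of the volumes `1751 … 1800` lies in the list of the bucket of its `a·b` (423 shapes). [original] -/
theorem m2c1751 : TB4Stat.m2V 50 1751 = true := by decide +kernel

set_option maxHeartbeats 0 in
/-- Completeness chunk: every sorted candidate shape of the volumes `1801 … 1850` lies in the list of the bucket of its `a·b` (378 shapes). [original] -/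
theorem m2c1801 : TB4Stat.m2V 50 1801 = true := by decide +kernel

set_option maxHeartbeats 0 in
/-- Completeness chunk: every sorted candidate shape of the volumes `1851 … 1900` lies in the list of the bucket of its `a·b` (389 shapes). [original] -/
theorem m2c1851 : TB4Stat.m2V 50 1851 = true := by decide +kernel

set_option maxHeartbeats 0 in
/-- Completeness chunk: every sorted candidate shape of the volumes `1901 … 1950` lies in the list of the bucket of its `a·b` (403 shapes). [original] -/
theorem m2c1901 : TB4Stat.m2V 50 1901 = true := by decide +kernel

set_option maxHeartbeats 0 in
/-- Completeness chunk: every sorted candidate shape of the volumes `1951 … 2000` lies in the list of the bucket of its `a·b` (394 shapes). [original] -/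
theorem m2c1951 : TB4Stat.m2V 50 1951 = true := by decide +kernel

end Summit.MatrixMultiplication.MatrixMultiplication.Theorems.TB4Stat
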